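import Summits.HodgeConjecture.CorCM.GaloisTwoPowerStructuredNondegenerate
import HarnessLib

/-!
# An unconditional slice of the `2`-power classification: a cyclic subgroup `⟨a⟩ ∋ c` containing all squares forces
# (H2), hence `Gal ∈ {C, Q, C × C₂, Q × C₂}`; in particular for an automorphism of order `[K:ℚ]/2`

COR-CM (cell `pub-hodgecm2`), binder seat b04 (gen 35), count-neutral own lane «Galois-CM-type classification».  KERNEL ONLY:
theorems; no definition, no named fact, no `sorry`.  `HC_CM` is neither used nor claimed.

The `2`-power classification (`CorCM/GaloisTwoPowerClassification`, same session) is conditional on its degree-`32` base only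
through (H2) «`σ⁴ = 1 ⟹ σ² ∈ {1, c}`»; gen 34's (R1) turns GOOD + (H2) into STRUCT (`Gal = H·E`, `H ∋ c` cyclic or generalised
quaternion, `E` central of order `≤ 2`) unconditionally for `[K:ℚ] = 2^n ≥ 64`.  HERE is a cheap UNCONDITIONAL source of (H2):
if some cyclic subgroup `⟨a⟩` of `Gal(K/ℚ)` contains every square `g²` and complex conjugation `c`, then every `σ` with `σ⁴ = 1` has
`σ² ∈ ⟨a⟩` of order `≤ 2`, i.e. `σ² ∈ {1, c}` (`c` is THE involution of `⟨a⟩`).  For `⟨a⟩` of index `2` (an automorphism of order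
`[K:ℚ]/2 = 2^(n-1)`) the hypothesis `c ∈ ⟨a⟩` is automatic in a GOOD field: otherwise `Gal = ⟨a⟩ × ⟨c⟩` is abelian with `c` in no
cyclic subgroup of index `≤ 2`, which the abelian classification (gens 15–16) makes BAD.  So, with NO degree-`32` hypothesis:

* `sq_eq_of_forall_sq_mem_zpowers` (group lemma) — squares in `⟨a⟩ ∋ c` ⟹ (H2).
* **`struct_of_forall_sq_mem_zpowers`** — GOOD, `[K:ℚ] = 2^n ≥ 64`, `g² ∈ ⟨a⟩ ∀ g`, `c ∈ ⟨a⟩` ⟹ STRUCT.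
* **`complexConj_mem_zpowers_of_orderOf`** / **`struct_of_orderOf_eq_half`** — GOOD, `[K:ℚ] = 2^n ≥ 64`, `orderOf a = 2^(n-1)` ⟹
  `c ∈ ⟨a⟩` (indeed `c = a^(2^(n-2))`) and STRUCT — so `Gal(K/ℚ)` is `C_{2^n}`, `C_{2^(n-1)} × C₂` with `c ∈ C_{2^(n-1)}`, or `Q_{2^n}`:
  the GOOD Galois CM fields of `2`-power degree `≥ 64` with an automorphism of order `[K:ℚ]/2` are classified outright (the groups
  `D`, `SD`, `M` of order `2^n` and `C_{2^(n-1)} × C₂` with `c ∉ C_{2^(n-1)}` are BAD).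
* `good_iff_struct_of_orderOf_eq_half` — the same as an equivalence (⟸ by `CorCM/GaloisTwoPowerStructuredNondegenerate`).

## References

* [Rotman1995] J. J. Rotman, *An Introduction to the Theory of Groups*, 4th ed., GTM 148, Springer 1995, Thm. 5.46.
* [Kubota1965] T. Kubota, *On the field extension by complex multiplication*, Trans. AMS 118 (1965), §2 and §4 Lemma 2.
* [Shimura1998] G. Shimura, *Abelian Varieties with Complex Multiplication and Modular Functions*, §8.2 Prop. 26, §18.2.
* [Gordon1999HodgeAVSurvey] B. B. Gordon, *A survey of the Hodge conjecture for abelian varieties*, Thm. 6.4, §9.3, §9.4.3.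
-/

noncomputable section

open CategoryTheory CategoryTheory.Limits NumberField
open scoped BigOperators

namespace Summit.HodgeConjecture.CorCM.GaloisModels

open Literature.NumberTheory.ComplexMultiplication
open Literature.AlgebraicGeometry.Motives (AbelianVariety CMType)
open Literature.AlgebraicGeometry.HodgeTheory
open Literature.AlgebraicGeometry.Pohlmann1968
open Summit.HodgeConjecture.CorCM.GaloisRank

/-! ## §1 The group lemma -/

section Group

variable {G : Type*} [Group G]

/-- **Squares in a cyclic `2`-group `⟨a⟩ ∋ c` ⟹ (H2).**  `orderOf a = 2^m`, `c ∈ ⟨a⟩` an involution, every square `g²` in `⟨a⟩`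
⟹ every `σ` with `σ⁴ = 1` has `σ² ∈ {1, c}`. [folklore] -/
theorem sq_eq_of_forall_sq_mem_zpowers {a c : G} {m : ℕ} (ha : orderOf a = 2 ^ m) (hcc : c * c = 1) (hc1 : c ≠ 1)
    (hca : c ∈ Subgroup.zpowers a) (hsq : ∀ g : G, g * g ∈ Subgroup.zpowers a) (σ : G) (hσ : σ ^ 4 = 1) :
    σ * σ = 1 ∨ σ * σ = c := by
  by_cases h1 : σ * σ = 1
  · exact Or.inl h1
  · right
    have h4 : σ * σ * (σ * σ) = 1 := by
      rw [show σ * σ * (σ * σ) = σ ^ 4 by simp only [pow_succ, pow_zero, one_mul, mul_assoc]]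
      exact hσ
    exact involution_eq_of_mem_zpowers ha (hsq σ) h4 h1 hca hcc hc1

end Group

/-! ## §2 Galois dress -/

section Field

variable {K : Type} [Field K] [NumberField K] [IsCMField K] [IsGalois ℚ K]

/-- **GOOD + all squares in a cyclic subgroup containing `c` ⟹ STRUCT.**  `K` Galois CM of degree `2^n`, `n ≥ 6`, every primitive CM
type nondegenerate; `a ∈ Gal(K/ℚ)` with `g² ∈ ⟨a⟩` for all `g` and complex conjugation `c ∈ ⟨a⟩`.  Then `Gal(K/ℚ) = H·E` with
`H.IsComplement' E`, `E` central of exponent `2`, `|E| ≤ 2`, `c ∈ H ∖ E`, `H` cyclic or generalised quaternion (unconditionally — no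
degree-`32` hypothesis). [cite: Rotman1995, Thm. 5.46] [cite: Shimura1998, §8.2 Prop. 26 and §18.2] -/
theorem struct_of_forall_sq_mem_zpowers {n : ℕ} (hdeg : Module.finrank ℚ K = 2 ^ n) (hn : 6 ≤ n)
    (hgood : ∀ (Φ : CMType K) (φ : K →+* ℂ), IsPrimitive (ℂ ≃+* ℂ) Φ.1 φ → IsNondegenerate Φ) (a : K ≃ₐ[ℚ] K)
    (hsq : ∀ g : K ≃ₐ[ℚ] K, g * g ∈ Subgroup.zpowers a)
    (hca : (IsCMField.complexConj K).restrictScalars ℚ ∈ Subgroup.zpowers a) :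
    ∃ (H E : Subgroup (K ≃ₐ[ℚ] K)) (k : ℕ), H.IsComplement' E ∧ (IsCMField.complexConj K).restrictScalars ℚ ∈ H ∧
      (IsCMField.complexConj K).restrictScalars ℚ ∉ E ∧ (∀ e ∈ E, e * e = 1 ∧ ∀ g : K ≃ₐ[ℚ] K, g * e = e * g) ∧
      Nat.card E ≤ 2 ∧ Nat.card H = 2 ^ k ∧ (IsCyclic H ∨ (3 ≤ k ∧ Nonempty (H ≃* QuaternionGroup (2 ^ (k - 2))))) := by
  classical
  have hcc := model_complexConj_mul_self (MulEquiv.refl (K ≃ₐ[ℚ] K)) (c₀ := (IsCMField.complexConj K).restrictScalars ℚ) rfl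
  have hc1 := model_complexConj_ne_one (MulEquiv.refl (K ≃ₐ[ℚ] K)) (c₀ := (IsCMField.complexConj K).restrictScalars ℚ) rfl
  have hcard : Nat.card (K ≃ₐ[ℚ] K) = 2 ^ n := by
    rw [Nat.card_eq_fintype_card, card_model_eq_finrank (MulEquiv.refl (K ≃ₐ[ℚ] K)), hdeg]
  obtain ⟨m, -, hm⟩ := (Nat.dvd_prime_pow Nat.prime_two).1 (hcard ▸ orderOf_dvd_natCard a)
  exact exists_isComplement'_card_le_two_of_forall_isNondegenerate hdeg hn hgood
    (sq_eq_of_forall_sq_mem_zpowers hm hcc hc1 hca hsq)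

/-- **An automorphism of order `[K:ℚ]/2` contains complex conjugation in its powers** (GOOD fields of degree `2^n ≥ 64`): if
`orderOf a = 2^(n-1)` then `c ∈ ⟨a⟩`, i.e. `c = a^(2^(n-2))`.  (Otherwise `Gal(K/ℚ) = ⟨a⟩ × ⟨c⟩` is abelian and `c` lies in no cyclic
subgroup of index `≤ 2` — BAD by the abelian classification.) [cite: Kubota1965, §4 Lemma 2] [cite: Shimura1998, §8.2 Prop. 26]
[cite: Gordon1999HodgeAVSurvey, §9.4.3] -/
theorem complexConj_mem_zpowers_of_orderOf {n : ℕ} (hdeg : Module.finrank ℚ K = 2 ^ n) (hn : 6 ≤ n)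
    (hgood : ∀ (Φ : CMType K) (φ : K →+* ℂ), IsPrimitive (ℂ ≃+* ℂ) Φ.1 φ → IsNondegenerate Φ) (a : K ≃ₐ[ℚ] K)
    (ha : orderOf a = 2 ^ (n - 1)) :
    (IsCMField.complexConj K).restrictScalars ℚ ∈ Subgroup.zpowers a ∧
      (IsCMField.complexConj K).restrictScalars ℚ = a ^ 2 ^ (n - 2) := by
  classical
  set c := (IsCMField.complexConj K).restrictScalars ℚ with hc
  have hcc : c * c = 1 := model_complexConj_mul_self (MulEquiv.refl (K ≃ₐ[ℚ] K)) (by simp [hc])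
  have hc1 : c ≠ 1 := model_complexConj_ne_one (MulEquiv.refl (K ≃ₐ[ℚ] K)) (by simp [hc])
  have hccen : ∀ g : K ≃ₐ[ℚ] K, g * c = c * g := fun g =>
    (model_complexConj_comm (MulEquiv.refl (K ≃ₐ[ℚ] K)) (by simp [hc]) g).symm
  have hcard : Nat.card (K ≃ₐ[ℚ] K) = 2 ^ n := by
    rw [Nat.card_eq_fintype_card, card_model_eq_finrank (MulEquiv.refl (K ≃ₐ[ℚ] K)), hdeg]
  set A := Subgroup.zpowers a with hA
  have hAidx : A.index = 2 := by
    have h1 := A.index_mul_card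
    rw [hA, Nat.card_zpowers, ha, hcard, show 2 ^ n = 2 * 2 ^ (n - 1) by rw [← pow_succ', Nat.sub_add_cancel (by omega)]]
      at h1
    exact Nat.eq_of_mul_eq_mul_right (by positivity) h1
  -- the involution of `⟨a⟩` is `a^(2^(n-2))`
  have hαinv : a ^ 2 ^ (n - 2) * a ^ 2 ^ (n - 2) = 1 := by
    rw [← pow_add, ← two_mul, ← pow_succ', show n - 2 + 1 = n - 1 by omega, ← ha, pow_orderOf_eq_one]
  have hαne : a ^ 2 ^ (n - 2) ≠ 1 := by
    intro h
    have h2 := orderOf_dvd_of_pow_eq_one h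
    rw [ha] at h2
    have := (Nat.pow_dvd_pow_iff_le_right (by norm_num : 1 < 2)).1 h2
    omega
  -- `c ∈ ⟨a⟩`; otherwise `Gal = ⟨a⟩ × ⟨c⟩` is abelian and not thin
  have hca : c ∈ A := by
    by_contra hca
    -- every element is `a^i` or `a^i c`
    have hform : ∀ g : K ≃ₐ[ℚ] K, ∃ i : ℤ, g = a ^ i ∨ g = a ^ i * c := by
      intro g
      by_cases hg : g ∈ A
      · obtain ⟨i, hi⟩ := Subgroup.mem_zpowers_iff.1 hg
        exact ⟨i, Or.inl hi.symm⟩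
      · have hgc : g * c ∈ A := (Subgroup.mul_mem_iff_of_index_two hAidx).2 (iff_of_false hg hca)
        obtain ⟨i, hi⟩ := Subgroup.mem_zpowers_iff.1 hgc
        refine ⟨i, Or.inr ?_⟩
        rw [hi, mul_assoc, hcc, mul_one]
    have haa : ∀ i j : ℤ, a ^ i * a ^ j = a ^ j * a ^ i := fun i j => by rw [← zpow_add, ← zpow_add, add_comm]
    have hcomm : ∀ g h : K ≃ₐ[ℚ] K, g * h = h * g := by
      intro g h
      obtain ⟨i, rfl | rfl⟩ := hform g <;> obtain ⟨j, rfl | rfl⟩ := hform h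
      · exact haa i j
      · calc a ^ i * (a ^ j * c) = (a ^ i * a ^ j) * c := by group
          _ = (a ^ j * a ^ i) * c := by rw [haa]
          _ = a ^ j * (a ^ i * c) := by group
          _ = a ^ j * (c * a ^ i) := by rw [hccen (a ^ i)]
          _ = a ^ j * c * a ^ i := by group
      · calc a ^ i * c * a ^ j = a ^ i * (c * a ^ j) := by group
          _ = a ^ i * (a ^ j * c) := by rw [← hccen (a ^ j)]
          _ = (a ^ i * a ^ j) * c := by group
          _ = (a ^ j * a ^ i) * c := by rw [haa]
          _ = a ^ j * (a ^ i * c) := by group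
      · calc a ^ i * c * (a ^ j * c) = a ^ i * (c * a ^ j) * c := by group
          _ = a ^ i * (a ^ j * c) * c := by rw [← hccen (a ^ j)]
          _ = (a ^ i * a ^ j) * (c * c) := by group
          _ = (a ^ j * a ^ i) * (c * c) := by rw [haa]
          _ = a ^ j * (a ^ i * c) * c := by group
          _ = a ^ j * (c * a ^ i) * c := by rw [hccen (a ^ i)]
          _ = a ^ j * c * (a ^ i * c) := by group
    -- not thin: a cyclic subgroup `⟨z⟩ ∋ c` of index `≤ 2` would have `c` as its involution `z^(2^(j-1)) = (z²)^(2^(j-2)) ∈ ⟨a⟩`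
    have hα : ¬ ∃ z : K ≃ₐ[ℚ] K, c ∈ Subgroup.zpowers z ∧ (Subgroup.zpowers z).index ≤ 2 := by
      rintro ⟨z, hcz, hidx⟩
      obtain ⟨j, -, hj⟩ := (Nat.dvd_prime_pow Nat.prime_two).1 (hcard ▸ orderOf_dvd_natCard z)
      have hzidx : (Subgroup.zpowers z).index * 2 ^ j = 2 ^ n := by rw [← hj, ← Nat.card_zpowers, Subgroup.index_mul_card, hcard]
      have hj2 : 2 ≤ j := by
        by_contra hj2
        have h4 : 2 ^ j ≤ 2 := by interval_cases j <;> norm_num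
        have h64 : 64 ≤ 2 ^ n := le_trans (by norm_num) (Nat.pow_le_pow_right (by norm_num) hn : 2 ^ 6 ≤ 2 ^ n)
        nlinarith [hzidx, hidx, h4]
      obtain ⟨-, hcpow⟩ := eq_halfpower_of_mem_zpowers hj hcz hcc hc1
      apply hca
      have h2j : ((2 : ℤ) ^ (j - 1)) = 2 * 2 ^ (j - 2) := by
        rw [← pow_succ']
        congr 1
        omega
      rw [hcpow, h2j, zpow_mul, zpow_two]
      exact Subgroup.zpow_mem _ (Subgroup.mul_self_mem_of_index_two hAidx z) _
    have h32 : 32 ≤ Module.finrank ℚ K := by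
      rw [hdeg]
      exact le_trans (by norm_num) (Nat.pow_le_pow_right (by norm_num) hn : 2 ^ 6 ≤ 2 ^ n)
    obtain ⟨Φ, φ₀, X, ι, θ, H1, H2, -⟩ :=
      AbelianTwoPowerClassification.exists_simple_degenerate_of_not_thin_of_le_finrank hcomm (n := n - 1)
        (by rw [hdeg, Nat.sub_add_cancel (by omega)]) h32 hα
    exact H2 (hgood Φ φ₀ H1)
  refine ⟨hca, ?_⟩
  have := involution_eq_of_mem_zpowers (m := n - 1) ha hca hcc hc1 (Subgroup.npow_mem_zpowers a _) hαinv hαne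
  exact this

/-- **THE CLASSIFICATION FOR AN AUTOMORPHISM OF ORDER `[K:ℚ]/2`** (unconditional): `K` Galois CM of degree `2^n`, `n ≥ 6`, every
primitive CM type nondegenerate, `a ∈ Gal(K/ℚ)` of order `2^(n-1)`.  Then `Gal(K/ℚ) = H·E` with `H.IsComplement' E`, `E` central of
exponent `2`, `|E| ≤ 2`, `c ∈ H ∖ E`, `H` cyclic or generalised quaternion — so `Gal(K/ℚ)` is `C_{2^n}`, `C_{2^(n-1)} × C₂` (`c ∈ C_{2^(n-1)}`)
or `Q_{2^n}`; the dihedral, semidihedral and modular groups of order `2^n` and `C_{2^(n-1)} × C₂` with `c ∉ C_{2^(n-1)}` are BAD.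
[cite: Rotman1995, Thm. 5.46] [cite: Shimura1998, §8.2 Prop. 26 and §18.2] [cite: Gordon1999HodgeAVSurvey, §9.3 and §9.4.3] -/
theorem struct_of_orderOf_eq_half {n : ℕ} (hdeg : Module.finrank ℚ K = 2 ^ n) (hn : 6 ≤ n)
    (hgood : ∀ (Φ : CMType K) (φ : K →+* ℂ), IsPrimitive (ℂ ≃+* ℂ) Φ.1 φ → IsNondegenerate Φ) (a : K ≃ₐ[ℚ] K)
    (ha : orderOf a = 2 ^ (n - 1)) :
    ∃ (H E : Subgroup (K ≃ₐ[ℚ] K)) (k : ℕ), H.IsComplement' E ∧ (IsCMField.complexConj K).restrictScalars ℚ ∈ H ∧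
      (IsCMField.complexConj K).restrictScalars ℚ ∉ E ∧ (∀ e ∈ E, e * e = 1 ∧ ∀ g : K ≃ₐ[ℚ] K, g * e = e * g) ∧
      Nat.card E ≤ 2 ∧ Nat.card H = 2 ^ k ∧ (IsCyclic H ∨ (3 ≤ k ∧ Nonempty (H ≃* QuaternionGroup (2 ^ (k - 2))))) := by
  classical
  have hcard : Nat.card (K ≃ₐ[ℚ] K) = 2 ^ n := by
    rw [Nat.card_eq_fintype_card, card_model_eq_finrank (MulEquiv.refl (K ≃ₐ[ℚ] K)), hdeg]
  have hAidx : (Subgroup.zpowers a).index = 2 := by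
    have h1 := (Subgroup.zpowers a).index_mul_card
    rw [Nat.card_zpowers, ha, hcard, show 2 ^ n = 2 * 2 ^ (n - 1) by rw [← pow_succ', Nat.sub_add_cancel (by omega)]] at h1
    exact Nat.eq_of_mul_eq_mul_right (by positivity) h1
  exact struct_of_forall_sq_mem_zpowers hdeg hn hgood a (fun g => Subgroup.mul_self_mem_of_index_two hAidx g)
    (complexConj_mem_zpowers_of_orderOf hdeg hn hgood a ha).1

/-- **… as an equivalence**: for `K` Galois CM of degree `2^n`, `n ≥ 6`, with an automorphism of order `2^(n-1)`: every primitive CM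
type is nondegenerate **iff** `Gal(K/ℚ) = H·E` as above. [cite: Rotman1995, Thm. 5.46] [cite: Kubota1965, §2 and §4 Lemma 2]
[cite: Shimura1998, §8.2 Prop. 26 and §18.2] -/
theorem good_iff_struct_of_orderOf_eq_half {n : ℕ} (hdeg : Module.finrank ℚ K = 2 ^ n) (hn : 6 ≤ n) (a : K ≃ₐ[ℚ] K)
    (ha : orderOf a = 2 ^ (n - 1)) :
    (∀ (Φ : CMType K) (φ : K →+* ℂ), IsPrimitive (ℂ ≃+* ℂ) Φ.1 φ → IsNondegenerate Φ) ↔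
      ∃ (H E : Subgroup (K ≃ₐ[ℚ] K)) (k : ℕ), H.IsComplement' E ∧ (IsCMField.complexConj K).restrictScalars ℚ ∈ H ∧
        (IsCMField.complexConj K).restrictScalars ℚ ∉ E ∧ (∀ e ∈ E, e * e = 1 ∧ ∀ g : K ≃ₐ[ℚ] K, g * e = e * g) ∧
        Nat.card E ≤ 2 ∧ Nat.card H = 2 ^ k ∧ (IsCyclic H ∨ (3 ≤ k ∧ Nonempty (H ≃* QuaternionGroup (2 ^ (k - 2))))) := by
  refine ⟨fun hgood => struct_of_orderOf_eq_half hdeg hn hgood a ha, ?_⟩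
  rintro ⟨H, E, k, hHE, hcH, -, hE, hEcard, hHcard, hstruct⟩ Φ φ hprim
  exact isNondegenerate_of_isPrimitive_of_struct hdeg (by omega) H E k hHE hcH hE hEcard hHcard hstruct φ hprim

end Field

end Summit.HodgeConjecture.CorCM.GaloisModels
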